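import Summits.BirchSwinnertonDyer.BirchSwinnertonDyer.Theses.PolyaAxisDoorRankThree
import HarnessLib

/-!
# BirchSwinnertonDyer / PolyaAxisDoorRankThree — the DOOR KERNEL (support item stmt-BirchSwinnertonDyer-24267
# `PolyaDoorKernelRankThree`)

Route `route-BirchSwinnertonDyer-PolyaAxisDoorRankThree` (D-0145 ideator line bsd-idea-4 #5, RANK 3, archimedean
lever: the Descartes–Laguerre–Pólya variation-diminishing bound for Hecke's kernel `y ↦ f_E(iy)` folded by Fricke,
`r_an ≤ 2Z⁺ + [w = −1]`).  KERNEL: from the print pack `PublishedInputsPolya` — (i) the axis inequality «one strict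
sign change of `Re f(iy)` above `1/√N` ⇒ `r_an(W) ≤ 3` (and `≤ 2` if `w = +1`)», (ii) Gross–Zagier–Kolyvagin — every
elliptic `W/ℚ` with `w(W) = −1`, `rank W(ℚ) ≥ 2` and the one-sign-change pattern for its newform has `r_an(W) = 3`:
(i) gives `r_an ≤ 3`, `w = −1` gives `r_an` odd (unconditional half of parity), GZK gives `r_an ≥ 2`
(`rank ≥ 2`) — the tree's `analyticRank_eq_three_of_rootNumber_eq_neg_one` (Buhler–Gross–Zagier / Cremona §2.13
certificate shape).  (The assembly item is the sibling file `PolyaAxisDoorRankThreeAssembly`.)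
Critic idea-crit-5 VERDICT #23 (01:00Z): "24267 and Assembly/closes are provable now — land them"; tribunal T1 (01:12Z):
"Kernel 24267 certified PROVABLE NOW — cell may close it; Assembly 24268 likewise".

This is a DOOR: nothing here proves a class theorem at rank `3`; the supply crux and the leaf are NOT proved; BSD is NOT
proved by it.  PARTITION: none — r_an ≥ 2 (here = 3), summit axis S0; TWIN (D-0056): n/a. B1 honesty: four lines of
bookkeeping over two published inputs taken as the item's own antecedent.
-/

set_option linter.dupNamespace false

namespace Summit.BirchSwinnertonDyer.BirchSwinnertonDyer.Theorems

open Literature.NumberTheory.EllipticCurves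
  Summit.BirchSwinnertonDyer.BirchSwinnertonDyer.Theses.PolyaAxisDoorRankThree

/-- **The support item `PolyaDoorKernelRankThree` holds** (stmt-BirchSwinnertonDyer-24267): from the axis inequality
(i) and Gross–Zagier–Kolyvagin (ii), `w(W) = −1`, `rank W(ℚ) ≥ 2` and one strict sign change of `Re f(iy)` above the
Fricke point give `r_an(W) = 3` (`analyticRank_eq_three_of_rootNumber_eq_neg_one`: `≤ 3` by (i), odd by the sign,
`≥ 2` by GZK). [cite: CremonaAlgorithms1997, §2.13] [cite: Darmon2004, Thm. 3.22] [cite: PolyaSzego1976, Part V Probl. 77, 80] -/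
theorem polyaDoorKernelRankThree_proof :
    Summit.BirchSwinnertonDyer.BirchSwinnertonDyer.Theses.PolyaAxisDoorRankThree.PolyaDoorKernelRankThree := by
  unfold Summit.BirchSwinnertonDyer.BirchSwinnertonDyer.Theses.PolyaAxisDoorRankThree.PolyaDoorKernelRankThree
    Summit.BirchSwinnertonDyer.BirchSwinnertonDyer.Theses.PolyaAxisDoorRankThree.PublishedInputsPolya
  rintro ⟨hi, hGZK⟩ W _ hw hr ⟨N, hN, f, hf, hc⟩
  exact analyticRank_eq_three_of_rootNumber_eq_neg_one (W := W) hGZK hw (hi W N f hf hc).1 hr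

end Summit.BirchSwinnertonDyer.BirchSwinnertonDyer.Theorems
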